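import Summits.MatrixMultiplication.MatrixMultiplication.Theorems.SoloBlindCwBasisGroupNoGo
import HarnessLib

/-!
# The sumset of a CW-basis group degeneration of `T_{cw,2}^{⊠N}` has at least `4^N` elements

For a group degeneration (or realization) of the support of `T_{cw,2}^{⊠N}` in the Coppersmith–Winograd
basis — maps `α β γ : (Fin N → Fin 3) → H` into an abelian group, `u : H`, leg weights `ω₁ ω₂ ω₃` with
order `h`, support triples on `α a + β b + γ c = u` with weight exactly `h`, all other solutions heavier
(the data of `four_pow_le_card_of_cwDegeneration`) — the character decomposition of the restricted
structure tensor of `ℂ[H]` has `|H|` terms `a_χ ⊗ b_χ ⊗ c_χ` with `a_χ = χ ∘ α`, `b_χ = χ ∘ β`, and the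
matrices `a_χ ⊗ b_χ` span exactly the functions of `α a + β b`: their span has dimension
`σ := |{α a + β b}|`, the size of the **sumset** `α(A) + β(B)`.  Re-expressing the third legs in a basis of
that span (the one-slice / "free lunch" bookkeeping of asymptotic-rank speedup theorems, arXiv:2605.21738
§5, Prop. 5.4 at `s = 0`) bounds the rank of the restricted tensor — hence `R`, resp. `bR`, of
`T_{cw,2}^{⊠N}` — by `σ ≤ |H|` instead of `|H|`.  This file shows that the refinement is empty in the CW
basis:

**Theorem** (`four_pow_le_card_sumset_of_cwDegeneration`).  For every such datum, `4 ^ N ≤ σ`; `H` need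
not be finite.  Indeed the injective family `Ψ(L, M) = α z_L + β t_M` of
`zLeg_tLeg_injective` (the key step of `four_pow_le_card_of_cwDegeneration`) consists of sums
`α a + β b`.  With `H = (ℤ/4)^N` and the product realization the sumset is all of `H`, so `4^N` is attained
(`cwRealization_zmod4_pow`).  Consequently no CW-basis group degeneration, in any abelian group and for
any `N`, can certify `R(T_{cw,2}^{⊠N}) < 4^N` even through the sumset refinement; it refines
`four_pow_le_card_of_cwDegeneration` (`4^N ≤ |H|`, finite `H`), since `|α(A)+β(B)| ≤ |H|`.

## References
* D. Coppersmith, S. Winograd, *Matrix multiplication via arithmetic progressions*, J. Symb. Comput. 9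
  (1990), §6 (the `T_{cw,q}` identity), §11.
* "Asymptotic Rank Speedup Theorems, Revisited", arXiv:2605.21738 (2026), §5 (one-slice speedups:
  Thm 5.1, Props 5.3–5.4) and §7 (Prop 7.1, Cor 7.1: `R̃(T_{cw,2}) < 3.931`).
* J. Alman, V. Vassilevska Williams, arXiv:1712.07246 §3.2; arXiv:1810.08671 §7 (group degenerations
  `CW_q ⊴ T_{ℤ/(q+2)}`).
-/

namespace Summit.MatrixMultiplication.MatrixMultiplication.Theorems

set_option linter.dupNamespace false

section CwBasisSumset

variable {N : ℕ} {H : Type*} [AddCommGroup H]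

variable (α β γ : (Fin N → Fin 3) → H) (u : H) (ω₁ ω₂ ω₃ : (Fin N → Fin 3) → ℕ) (h : ℕ)
  (hsupp : ∀ a b c : Fin N → Fin 3, (∀ i, cwAt (a i) (b i) (c i) = true) →
    α a + β b + γ c = u ∧ ω₁ a + ω₂ b + ω₃ c = h)
  (hcut : ∀ a b c : Fin N → Fin 3, α a + β b + γ c = u → ¬ (∀ i, cwAt (a i) (b i) (c i) = true) →
    h < ω₁ a + ω₂ b + ω₃ c)

/-- The sumset `α(A) + β(B)` of a pair of leg maps, as a `Finset` of `H`. -/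
noncomputable def legSumset (α β : (Fin N → Fin 3) → H) : Finset H := by
  classical
  exact Finset.univ.image fun ab : (Fin N → Fin 3) × (Fin N → Fin 3) => α ab.1 + β ab.2

omit hsupp hcut in
/-- Membership in the sumset. -/
theorem mem_legSumset (a b : Fin N → Fin 3) : α a + β b ∈ legSumset α β := by
  classical
  unfold legSumset
  exact Finset.mem_image.2 ⟨(a, b), Finset.mem_univ _, rfl⟩

include hsupp hcut in
/-- **Sumset no-go in the CW basis.** For every CW-basis group degeneration datum of `T_{cw,2}^{⊠N}`
(any abelian group `H`, three maps, three weights), the sumset `α(A) + β(B)` — whose size bounds the rank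
of the restricted group tensor from above by the one-slice bookkeeping — has at least `4 ^ N` elements.
[new] -/
theorem four_pow_le_card_sumset_of_cwDegeneration : 4 ^ N ≤ (legSumset α β).card := by
  classical
  let Ψ : (Fin N → Bool) × (Fin N → Bool) → H := fun lm => α (zLeg lm.1) + β (tLeg lm.2)
  have inj : Function.Injective Ψ := by
    rintro ⟨l, m⟩ ⟨l', m'⟩ hΨ
    obtain ⟨h1, h2⟩ := zLeg_tLeg_injective α β γ u ω₁ ω₂ ω₃ h hsupp hcut l m l' m' hΨ
    rw [h1, h2]
  have hsub : (Finset.univ.image Ψ) ⊆ legSumset α β := by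
    intro x hx
    obtain ⟨lm, -, rfl⟩ := Finset.mem_image.1 hx
    exact mem_legSumset α β (zLeg lm.1) (tLeg lm.2)
  have hcard : (Finset.univ.image Ψ).card = 4 ^ N := by
    rw [Finset.card_image_of_injective _ inj, Finset.card_univ]
    have h4 : (4 : ℕ) ^ N = 2 ^ N * 2 ^ N := by rw [← mul_pow]; norm_num
    rw [h4]
    simp [Fintype.card_prod, Fintype.card_bool, Fintype.card_fin]
  calc 4 ^ N = (Finset.univ.image Ψ).card := hcard.symm
    _ ≤ (legSumset α β).card := Finset.card_le_card hsub

omit hsupp hcut in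
/-- **Exact realizations.** If `α a + β b + γ c = u ↔ (a,b,c) ∈ supp T_{cw,2}^{⊠N}` (CW basis), the
sumset `α(A) + β(B)` has at least `4^N` elements, so the sumset refinement `R ≤ |α(A)+β(B)|` of
`R ≤ |H|` cannot go below `4^N` either. [new] -/
theorem four_pow_le_card_sumset_of_cwRealization (α β γ : (Fin N → Fin 3) → H) (u : H)
    (hiff : ∀ a b c : Fin N → Fin 3, α a + β b + γ c = u ↔ ∀ i, cwAt (a i) (b i) (c i) = true) :
    4 ^ N ≤ (legSumset α β).card :=
  four_pow_le_card_sumset_of_cwDegeneration α β γ u (fun _ => 0) (fun _ => 0) (fun _ => 0) 0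
    (fun a b c habc => ⟨(hiff a b c).2 habc, rfl⟩)
    (fun a b c habc hn => absurd ((hiff a b c).1 habc) hn)

end CwBasisSumset

/-! ### Sharpness: for the product realization in `(ℤ/4)^N` the sumset is everything -/

section SumsetSharpness

/-- In `(ℤ/4)^N` with the product realization `α = β = γ =` the CW embedding `0 ↦ 0, 1 ↦ 1, 2 ↦ 3`
(`cwRealization_zmod4_pow`), every element is a sum `α a + β b`: the sumset bound `4^N` is attained.
[new] -/
theorem legSumset_zmod4_pow_eq_univ (N : ℕ) :
    legSumset (N := N) (fun a i => (![0, 1, 3] : Fin 3 → ZMod 4) (a i))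
      (fun b i => (![0, 1, 3] : Fin 3 → ZMod 4) (b i)) = Finset.univ := by
  classical
  apply Finset.eq_univ_of_forall
  intro x
  -- digitwise: 0 = 0+0, 1 = 1+0, 2 = 1+1, 3 = 3+0
  have hdig : ∀ z : ZMod 4, ∃ p : Fin 3 × Fin 3,
      (![0, 1, 3] : Fin 3 → ZMod 4) p.1 + (![0, 1, 3] : Fin 3 → ZMod 4) p.2 = z := by decide
  choose f hf using hdig
  have hx : (fun i => (![0, 1, 3] : Fin 3 → ZMod 4) ((fun i => (f (x i)).1) i)) +
      (fun i => (![0, 1, 3] : Fin 3 → ZMod 4) ((fun i => (f (x i)).2) i)) = x := by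
    funext i; simp [hf]
  rw [← hx]
  exact mem_legSumset _ _ _ _

/-- Hence the minimum of `|α(A) + β(B)|` over all CW-basis degeneration data at level `N` is exactly
`4^N`. [new] -/
theorem card_legSumset_zmod4_pow (N : ℕ) :
    (legSumset (N := N) (fun a i => (![0, 1, 3] : Fin 3 → ZMod 4) (a i))
      (fun b i => (![0, 1, 3] : Fin 3 → ZMod 4) (b i))).card = 4 ^ N := by
  rw [legSumset_zmod4_pow_eq_univ, Finset.card_univ]
  simp [ZMod.card, Fintype.card_fin]

end SumsetSharpness

end Summit.MatrixMultiplication.MatrixMultiplication.Theorems
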